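import Summits.BirchSwinnertonDyer.BirchSwinnertonDyer.Theorems.SylvesterTwoHeegnerIndexYinToric
import Summits.BirchSwinnertonDyer.BirchSwinnertonDyer.Theorems.SylvesterTwoHeegnerIndexYinToricNoTwoTorsion
import Summits.BirchSwinnertonDyer.BirchSwinnertonDyer.Theorems.SylvesterTwoHeegnerIndexYinDivisibilityIndex
import HarnessLib

/-!
# Route `SylvesterTwoHeegnerIndex` (rung K7t), item 19802 `HSYPointTwoDivisibleSevenModNine`:
# CONTENT ISOLATION of the registered research stub `stub_yinToricDecomposition`

Seat `leafhand-bsd-sylvestertwoheegne-5` g0 (prover; refill D-0181(3) step 4; director-bsd (685)/(689)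
rails: LAND-ONLY, `--supports stmt-BirchSwinnertonDyer-19802 --as helper`). THEOREMS ONLY: no definition,
no named fact, no instance, no notation, no `sorry`.

WHAT THIS FILE SETTLES (kernel). The registered skeleton of item 19802 (S-19802/toric, sha16
`ea25de9eb9afcd52`) has three stubs: the print conjunction `PublishedFactsTwoPlus`, Yin's PREPRINT display
`SylvesterTwoYin.YinHeightDisplay`, and the cell's DERIVED CLAIM `SylvesterTwoYinToric.YinToricDecomposition`
(«Yin's point decomposes torically»: one display point `Y` per prime `p ≡ 7 (9)` TOGETHER WITH toric data
`(L, c, θ, N, R, T)` — a Galois `L/K` with `Gal(L/K) ⊆ {1, c}`, `B(L)[2] = 0`, an additive `θ`, an odd `N`,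
the TRACE RELATION `N•ι(Y) = −θ(R + cR) + T` and the torsion ANTI-TRACE `R − cR`). bsd-cm-two g9 proved the
forward direction `exists_twoDivisible_displayPoint_of_toric` (toric data ⟹ `Y ∈ 2B(K) + tors`). This file
proves the CONVERSE and the resulting equivalences:

* §1 `exists_toricData_of_eq_two_smul_add` — for ANY model `B/ℚ`, any number field `K` with `B(K)[2] = 0`
  and any `Y = 2•Y′ + T′` (`T′` torsion) the toric clause holds with the INERT witness `L = K`, `c = 1`,
  `θ = −id`, `N = 1`, `R = ι Y′`, `T = ι T′`: the typed toric-data clause carries no information beyond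
  `2`-divisibility modulo torsion (as a hypothesis SHAPE it is exactly what the descent §1 of
  `…Theorems.SylvesterTwoHeegnerIndexYinToric` consumes; as a CLAIM it is not stronger).
* §2 `yinToricDecomposition_iff_forall_exists_twoDivisible_displayPoint` — `YinToricDecomposition` IS the
  «one `2`-divisible display point per prime, `K` handed over» statement of x1b GEN 52 (`B(K)[2] = 0` for
  every model of `E_p` over a quadratic field is x1b GEN 53's `eq_zero_of_two_nsmul_eq_zero_of_finrank_eq_two`).
* §3 modulo the OTHER registered stub `YinHeightDisplay`: `YinToricDecomposition ↔ ShaAnTwoIntegralSevenModNine`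
  (`0 ≤ ord₂ #Ш_an(E_p)` for every prime `p ≡ 7 (9)`) `↔ YinPointTwoDivisibleSevenModNine` (CONJECTURE C′).
  The `←` direction builds the display point from the rational generator alone: the display forces
  `ord₂ #Ш_an(B) = 2n` (`exists_int_padicValRat_two_shaAn_eq_of_yinDisplay`), `2`-integrality gives `n ≥ 0`,
  and `Y = 2^{n+1}•ι P`, `u = 4ⁿ/#Ш_an(B)` stand in display position `(u·qB)·ĥ(ι P) = 2⁻²·ĥ(Y)` with
  `Y = 2•(2ⁿ•ι P)`.

READING FOR THE PLANNER (D-0014 — the plan is not this seat's). The research content of skeleton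
S-19802/toric is EXACTLY the `2`-integrality of `#Ш_an(E_p)` for ALL primes `p ≡ 7 (mod 9)` (no cube
condition) — strictly more than item 19802 (which carries `3 ∤ cube mod p` and is closed modulo the prints
{`PublishedFactsTwoPlus`, (G3′), #19} by `SylvesterTwoThmCPrintExact.hsyPointTwoDivisibleSevenModNine_of_publishedFactsTwoPlus_of_named`,
p794073); the «toric» wording of the stub adds nothing a prover could use or attack.

HONEST LABEL: kernel equivalences between hypothesis shapes; nothing here proves C′, THEOREM C, the display
or any conjunct of `PublishedFactsTwoPlus`; item 19802 is NOT closed; `X12.CMAtTwo` is NOT proved; BSD is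
proved for no curve.

## References
* H. Yin, *Gross–Zagier formula for the 4, 7 cases of Sylvester's conjecture*, arXiv:2607.01744 (2026),
  Thm. 1.1, Thm. 2.2, p. 12. PREPRINT (display and C′ are hypothesis shapes here).
* X. Yuan, S.-W. Zhang, W. Zhang, *The Gross–Zagier Formula on Shimura Curves*, Ann. of Math. Stud. 184
  (2013), §1.3.2 (source of the anti-trace reading; not used in the kernel).
* J. H. Silverman, *The Arithmetic of Elliptic Curves*, GTM 106 (2009), Thm. VIII.9.3 (b), (d)
  (`ĥ(mP) = m² ĥ(P)`, `ĥ` vanishes on torsion). [SilvermanAEC2009]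
* MEMO bsd-cm-two v2.10 §51–§52 (the C′ mechanism whose typed reading is `YinToricDecomposition`).
-/

set_option autoImplicit false
-- the Summit-side namespace `Summit.BirchSwinnertonDyer.BirchSwinnertonDyer.…` (summit = problem) is mandated by D-0017
set_option linter.dupNamespace false

noncomputable section

open scoped Classical

open WeierstrassCurve WeierstrassCurve.Affine WeierstrassCurve.Affine.Point
open Summit.BirchSwinnertonDyer.BirchSwinnertonDyer.Theorems.SylvesterTwoYin
  Summit.BirchSwinnertonDyer.BirchSwinnertonDyer.Theorems.SylvesterTwoYinOnePoint
  Summit.BirchSwinnertonDyer.BirchSwinnertonDyer.Theorems.SylvesterTwoYinToricDescent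
  Summit.BirchSwinnertonDyer.BirchSwinnertonDyer.Theorems.SylvesterTwoYinLower
  Literature.NumberTheory.EllipticCurves Literature.NumberTheory.EllipticCurves.HuShuYin2019

namespace Summit.BirchSwinnertonDyer.BirchSwinnertonDyer.Theorems.SylvesterTwoYinToric

/-! ## §1 The toric-data clause is inert: a `2`-divisible point decomposes torically over `L = K` -/

/-- **INERT TORIC DATA FOR A `2`-DIVISIBLE POINT.** `B/ℚ` any Weierstrass model, `K` any number field in
which `B` has no point of order `2`, `Y = 2•Y′ + T′ ∈ B(K)` with `T′` torsion. Then the toric clause of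
`YinToricDecomposition` holds for `Y` with the witness `L = K` (Galois over itself, `Gal = {1}`), `c = 1`,
`θ = −id`, `N = 1`, `R = ι Y′`, `T = ι T′`: the trace relation reads `ι Y = ι Y′ + ι Y′ + ι T′` and the
anti-trace `R − cR = 0` is torsion. So the typed «toric decomposition» is implied by — not only implies —
`2`-divisibility modulo torsion. [folklore] -/
theorem exists_toricData_of_eq_two_smul_add (B : WeierstrassCurve ℚ) (K : Type) [Field K] [NumberField K]
    (hK2 : ∀ Q : (B.baseChange K).toAffine.Point, (2 : ℕ) • Q = 0 → Q = 0)
    {Y Y' T' : (B.baseChange K).toAffine.Point} (hT' : IsOfFinAddOrder T')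
    (hY : Y = (2 : ℤ) • Y' + T') :
    ∃ (L : Type) (_ : Field L) (_ : NumberField L) (_ : Algebra K L) (_ : IsGalois K L)
        (c : L ≃ₐ[K] L) (θ : (B.baseChange L).toAffine.Point →+ (B.baseChange L).toAffine.Point)
        (N : ℤ) (R T : (B.baseChange L).toAffine.Point),
        (∀ σ : L ≃ₐ[K] L, σ = AlgEquiv.refl ∨ σ = c) ∧
        (∀ Q : (B.baseChange L).toAffine.Point, (2 : ℕ) • Q = 0 → Q = 0) ∧
        Odd N ∧ IsOfFinAddOrder T ∧
        TraceRelationAtTwo B K L c θ N Y R T ∧ AntiTraceIsTorsion B K L c R := by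
  refine ⟨K, inferInstance, inferInstance, Algebra.id K, inferInstance, AlgEquiv.refl,
    -(AddMonoidHom.id _), 1, Affine.Point.baseChange (W' := B) K K Y',
    Affine.Point.baseChange (W' := B) K K T', ?_, hK2, odd_one, ?_, ?_, ?_⟩
  · intro σ
    left
    ext x
    simpa using σ.commutes x
  · exact (Affine.Point.baseChange (W' := B) K K).isOfFinAddOrder hT'
  · -- the trace relation `1 • ι Y = -(-(ι Y′ + c (ι Y′))) + ι T′`
    unfold TraceRelationAtTwo
    rw [Affine.Point.map_baseChange, one_smul, AddMonoidHom.neg_apply, neg_neg, AddMonoidHom.id_apply,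
      hY, map_add, map_zsmul, two_smul]
  · -- the anti-trace `ι Y′ − c (ι Y′) = 0`
    unfold AntiTraceIsTorsion
    rw [Affine.Point.map_baseChange, sub_self]
    exact IsOfFinAddOrder.zero

/-! ## §2 `YinToricDecomposition` ⟺ one `2`-divisible display point per prime (`K` handed over) -/

/-- **THE CONVERSE OF `exists_twoDivisible_displayPoint_of_toric`.** If for every prime `p ≡ 7 (9)`, every
minimal `B ≅ E_p` with `#Ш_an(B) = qB`, every quadratic `K ∋ ω` with `rank_ℤ B(K) = 2` and every rational
generator `P` there is a display point `Y` (`2`-adic unit `u`, `(u·qB)·ĥ(ι P) = 2⁻²·ĥ(Y)`) which is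
`2`-divisible modulo torsion, then `YinToricDecomposition` holds: `B(K)[2] = 0` for every model of `E_p`
over a quadratic field (x1b GEN 53) and §1 supplies the toric data. [folklore] -/
theorem yinToricDecomposition_of_forall_exists_twoDivisible_displayPoint
    (hOneK : ∀ (p : ℕ), p.Prime → p % 9 = 7 →
      ∀ (B : WeierstrassCurve ℚ) [B.IsElliptic] [B.IsGloballyMinimal],
      (∃ C : VariableChange ℚ, C • B = cubeSumCurve (p : ℚ)) → ∀ (qB : ℚ), shaAn B = (qB : ℂ) →
      ∀ (K : Type) [Field K] [NumberField K] (ω : K), ω ^ 2 + ω + 1 = 0 → Module.finrank ℚ K = 2 →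
        (B.baseChange K).mordellWeilRank = 2 →
      ∀ (P : B.toAffine.Point), ¬ IsOfFinAddOrder (QuadraticDescent.incl K B P) →
        (∀ Q : B.toAffine.Point, ∃ m : ℤ,
          IsOfFinAddOrder (QuadraticDescent.incl K B Q - m • QuadraticDescent.incl K B P)) →
      ∃ (Y : (B.baseChange K).toAffine.Point) (u : ℚ), u ≠ 0 ∧ padicValRat 2 u = 0 ∧
        ((u * qB : ℚ) : ℝ) * canonicalHeight (QuadraticDescent.incl K B P) =
          (2 : ℝ) ^ (-2 : ℤ) * canonicalHeight Y ∧
        ∃ Y' T' : (B.baseChange K).toAffine.Point, IsOfFinAddOrder T' ∧ Y = (2 : ℤ) • Y' + T') :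
    YinToricDecomposition := by
  intro p hp h7 B _ _ hB qB hqB K _ _ ω hω h2K hrank P hP hgen
  obtain ⟨Y, u, hu0, hu, hid, Y', T', hT', hYeq⟩ := hOneK p hp h7 B hB qB hqB K ω hω h2K hrank P hP hgen
  obtain ⟨C, hC⟩ := hB
  have hp2 : p ≠ 2 := by rintro rfl; norm_num at h7
  have hK2 : ∀ Q : (B.baseChange K).toAffine.Point, (2 : ℕ) • Q = 0 → Q = 0 :=
    fun Q hQ ↦ eq_zero_of_two_nsmul_eq_zero_of_finrank_eq_two h2K hp hp2 B C hC Q hQ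
  exact ⟨Y, u, hu0, hu, hid, exists_toricData_of_eq_two_smul_add B K hK2 hT' hYeq⟩

/-- **`YinToricDecomposition` ⟺ ONE `2`-DIVISIBLE DISPLAY POINT PER PRIME (`K` handed over).** The forward
direction is bsd-cm-two g9's toric descent `exists_twoDivisible_displayPoint_of_toric`; the backward one is
§1's inert witness. Consequently every consumer of the toric binder (`…_of_toric`) and every consumer of the
one-point hypothesis (`…_of_forall_field`, x1b GEN 52) see the same statement. [folklore] -/
theorem yinToricDecomposition_iff_forall_exists_twoDivisible_displayPoint :
    YinToricDecomposition ↔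
    ∀ (p : ℕ), p.Prime → p % 9 = 7 →
      ∀ (B : WeierstrassCurve ℚ) [B.IsElliptic] [B.IsGloballyMinimal],
      (∃ C : VariableChange ℚ, C • B = cubeSumCurve (p : ℚ)) → ∀ (qB : ℚ), shaAn B = (qB : ℂ) →
      ∀ (K : Type) [Field K] [NumberField K] (ω : K), ω ^ 2 + ω + 1 = 0 → Module.finrank ℚ K = 2 →
        (B.baseChange K).mordellWeilRank = 2 →
      ∀ (P : B.toAffine.Point), ¬ IsOfFinAddOrder (QuadraticDescent.incl K B P) →
        (∀ Q : B.toAffine.Point, ∃ m : ℤ,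
          IsOfFinAddOrder (QuadraticDescent.incl K B Q - m • QuadraticDescent.incl K B P)) →
      ∃ (Y : (B.baseChange K).toAffine.Point) (u : ℚ), u ≠ 0 ∧ padicValRat 2 u = 0 ∧
        ((u * qB : ℚ) : ℝ) * canonicalHeight (QuadraticDescent.incl K B P) =
          (2 : ℝ) ^ (-2 : ℤ) * canonicalHeight Y ∧
        ∃ Y' T' : (B.baseChange K).toAffine.Point, IsOfFinAddOrder T' ∧ Y = (2 : ℤ) • Y' + T' :=
  ⟨exists_twoDivisible_displayPoint_of_toric, yinToricDecomposition_of_forall_exists_twoDivisible_displayPoint⟩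

/-! ## §3 Modulo Yin's display: `YinToricDecomposition` ⟺ `2`-integrality ⟺ CONJECTURE C′ -/

/-- `ord₂(2^{2k}/q) = 0` when `ord₂ q = 2k` (`q ≠ 0`). [folklore] -/
theorem padicValRat_two_pow_div_eq_zero {q : ℚ} (hq : q ≠ 0) {k : ℕ}
    (hv : padicValRat 2 q = 2 * (k : ℤ)) : padicValRat 2 ((2 : ℚ) ^ (2 * k) / q) = 0 := by
  have h22 : padicValRat 2 (2 : ℚ) = 1 := by simpa using padicValRat.self (p := 2) one_lt_two
  rw [padicValRat.div (pow_ne_zero _ two_ne_zero) hq, padicValRat.pow, h22, hv]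
  push_cast
  ring

/-- **`YinToricDecomposition` FROM THE DISPLAY AND THE `2`-INTEGRALITY OF `#Ш_an(E_p)`.** Granted
`YinHeightDisplay` (the other registered stub of S-19802/toric) and `ShaAnTwoIntegralSevenModNine`: for a prime
`p ≡ 7 (9)`, a minimal `B ≅ E_p` with `#Ш_an(B) = qB`, a quadratic `K ∋ ω` and a rational generator `P`, the
display forces `qB ≠ 0` and `ord₂ qB = 2n` with `n ≥ −1` (`exists_int_padicValRat_two_shaAn_eq_of_yinDisplay`),
`2`-integrality gives `n ≥ 0`, and `Y = 2^{n+1}•ι P`, `u = 4ⁿ/qB` (a `2`-adic unit) stand in display position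
`(u·qB)·ĥ(ι P) = 4ⁿ·ĥ(ι P) = 2⁻²·ĥ(Y)` with `Y = 2•(2ⁿ•ι P)` — then §2. No display POINT is used, only the
display's valuation bookkeeping. [cite-level reading: arXiv:2607.01744 Thm. 1.1, p. 12]
[cite: SilvermanAEC2009, Thm. VIII.9.3 (b)] -/
theorem yinToricDecomposition_of_yinDisplay_of_shaAnTwoIntegral (hY : YinHeightDisplay)
    (hI : ShaAnTwoIntegralSevenModNine) : YinToricDecomposition := by
  refine yinToricDecomposition_of_forall_exists_twoDivisible_displayPoint ?_
  intro p hp h7 B _ _ hB qB hqB K _ _ ω hω h2K hrank P hP hgen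
  obtain ⟨qB', hqB', hq0, n, hn, -⟩ := exists_int_padicValRat_two_shaAn_eq_of_yinDisplay hY hp (Or.inr h7) B hB
  have e : qB' = qB := by exact_mod_cast hqB'.symm.trans hqB
  subst e
  have hn0 : 0 ≤ n := by
    have h0 : 0 ≤ padicValRat 2 qB' := hI p hp h7 B hB qB' hqB
    omega
  obtain ⟨k, rfl⟩ := Int.eq_ofNat_of_zero_le hn0
  set X := QuadraticDescent.incl K B P with hX
  refine ⟨((2 : ℤ) ^ (k + 1)) • X, (2 : ℚ) ^ (2 * k) / qB', div_ne_zero (pow_ne_zero _ two_ne_zero) hq0,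
    padicValRat_two_pow_div_eq_zero hq0 hn, ?_, ((2 : ℤ) ^ k) • X, 0, IsOfFinAddOrder.zero, ?_⟩
  · -- the display identity `(4ᵏ/qB · qB)·ĥ(X) = 2⁻²·ĥ(2^{k+1}•X)`
    rw [div_mul_cancel₀ _ hq0, canonicalHeight_zsmul_holds]
    push_cast
    have key : (2 : ℝ) ^ (-2 : ℤ) * ((2 : ℝ) ^ (k + 1)) ^ 2 = (2 : ℝ) ^ (2 * k) := by
      rw [← pow_mul, show (k + 1) * 2 = 2 * k + 2 by ring, pow_add, zpow_neg, zpow_ofNat]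
      field_simp
    rw [← mul_assoc, key]
  · rw [add_zero, two_pow_succ_smul]

/-- **`YinToricDecomposition` ⟺ `2`-INTEGRALITY OF `#Ш_an(E_p)` ON `p ≡ 7 (9)`, modulo Yin's display.**
`→` is bsd-cm-two g9's `shaAnTwoIntegralSevenModNine_of_toric`; `←` is the inert construction above. So
the registered research stub `stub_yinToricDecomposition` of S-19802/toric, granted its sibling stub
`stub_yinHeightDisplay`, IS the statement `0 ≤ ord₂ #Ш_an(E_p)` for every prime `p ≡ 7 (mod 9)` — an
`L`-value statement without cube condition, OPEN. [cite-level reading: arXiv:2607.01744 Thm. 1.1, p. 12] -/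
theorem yinToricDecomposition_iff_shaAnTwoIntegral_of_yinDisplay (hY : YinHeightDisplay) :
    YinToricDecomposition ↔ ShaAnTwoIntegralSevenModNine :=
  ⟨fun hT ↦ shaAnTwoIntegralSevenModNine_of_toric ⟨hY, hT⟩,
    yinToricDecomposition_of_yinDisplay_of_shaAnTwoIntegral hY⟩

/-- **`YinToricDecomposition` ⟺ CONJECTURE C′ (`YinPointTwoDivisibleSevenModNine`), modulo Yin's display**
(through two g8's `yinPoint_iff_shaAnTwoIntegral_of_yinDisplay`). The toric road to C′ is therefore not a
weakening of C′: its one research stub is C′ itself. [cite-level reading: arXiv:2607.01744 Thm. 1.1, p. 12] -/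
theorem yinToricDecomposition_iff_yinPoint_of_yinDisplay (hY : YinHeightDisplay) :
    YinToricDecomposition ↔ YinPointTwoDivisibleSevenModNine :=
  (yinToricDecomposition_iff_shaAnTwoIntegral_of_yinDisplay hY).trans
    (yinPoint_iff_shaAnTwoIntegral_of_yinDisplay hY).symm

/-- **THE TORIC BINDER IS THE DISPLAY PLUS `2`-INTEGRALITY**: `PublishedFactsTwoYinToric ↔
YinHeightDisplay ∧ ShaAnTwoIntegralSevenModNine`. [cite-level reading: arXiv:2607.01744 Thm. 1.1, p. 12] -/
theorem publishedFactsTwoYinToric_iff_yinDisplay_and_shaAnTwoIntegral :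
    PublishedFactsTwoYinToric ↔ YinHeightDisplay ∧ ShaAnTwoIntegralSevenModNine :=
  ⟨fun h ↦ ⟨h.1, shaAnTwoIntegralSevenModNine_of_toric h⟩,
    fun h ↦ ⟨h.1, yinToricDecomposition_of_yinDisplay_of_shaAnTwoIntegral h.1 h.2⟩⟩

end Summit.BirchSwinnertonDyer.BirchSwinnertonDyer.Theorems.SylvesterTwoYinToric

end
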